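import Literature.NumberTheory.EllipticCurves.RankinSelbergWeightOneUnfolding
import Literature.NumberTheory.EllipticCurves.RankinSelbergBilinearStrip
import Literature.NumberTheory.Automorphic.EisensteinOrthogonality
import HarnessLib

/-!
# The unfolded Rankin–Selberg integral on the strip: integrability and the Dirichlet series

Topic `Literature/NumberTheory/EllipticCurves`; namespace
`Literature.NumberTheory.EllipticCurves.ModularForms`; theorems only (no definition, no named
fact). The right-hand side `2 ∫_P φ F̄ y^{s+2} dμ` of the unfolding
(`RankinSelbergWeightOneUnfolding.integral_domain_conj_eisensteinOne_mul_eq`, `P = {0 ≤ Re < 1}`,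
`dμ = dx dy/y²`):

* `integrableOn_rsIntegrand_stripFD` — **integrability on the strip** from growth bounds
  `|φ(τ)| ≤ C_φ e^{-2πy}(1 + y^{-A_φ})` (a cusp form) and `|F(τ)| ≤ C_F (y^A + y^{-A})`
  (a form of moderate growth), for `Re s > A + A_φ - 1` (in coordinates via the tree's
  `lintegral_strip_eq_lintegral_Ioi_Ico`, then four Gamma-type integrals);
* `setIntegral_stripFD_rsIntegrand` — **in coordinates**:
  `∫_P φ F̄ y^{s+2} dμ = ∫₀^∞ (∫₀¹ φ(x+iy) \overline{F(x+iy)} dx) yˢ dy`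
  (the tree's `Literature.NumberTheory.Automorphic.setIntegral_stripFD_eq`);
* `setIntegral_stripFD_rsIntegrand_qSeries` — **as a Dirichlet series**: if `φ, F` are the
  `q`-series with polynomially bounded coefficients `a` (`a(0) = 0`), `b`, then for `Re s > 2k`
  `∫_P φ F̄ y^{s+2} dμ = Γ(s+1) ∑_{m ≥ 1} a(m) \overline{b(m)} (4πm)^{-(s+1)}`
  (`RankinSelbergBilinearStrip.integral_Ioi_qSeries_mul_conj_mul_cpow`).

(Rankin 1939, §4; Shimura 1976, (2.4).)

## References

* R. A. Rankin, Proc. Cambridge Philos. Soc. 35 (1939), 357–372, §4.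
* G. Shimura, Comm. Pure Appl. Math. 29 (1976), §2.
-/

noncomputable section

open scoped MatrixGroups ENNReal NNReal ComplexConjugate
open MeasureTheory Set Filter Real
open UpperHalfPlane hiding I
open Literature.NumberTheory.Automorphic (stripFD pt pt_im pt_eq coe_pt measurableSet_stripFD
  setIntegral_stripFD_eq)

namespace Literature.NumberTheory.EllipticCurves.ModularForms

/-! ### The integrand in coordinates -/

/-- `rsIntegrand` at the point `x + iy`. [folklore] -/
theorem rsIntegrand_pt (φ F : ℍ → ℂ) (s : ℂ) {y : ℝ} (hy : 0 < y) (x : ℝ) :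
    rsIntegrand φ F s (pt x y) = φ (pt x y) * conj (F (pt x y)) * ((y : ℝ) : ℂ) ^ (s + 2) := by
  unfold rsIntegrand; rw [pt_im hy]

/-- Its norm: `‖rsIntegrand(x + iy)‖ = ‖φ‖ ‖F‖ y^{Re s + 2}`. [folklore] -/
theorem norm_rsIntegrand_pt (φ F : ℍ → ℂ) (s : ℂ) {y : ℝ} (hy : 0 < y) (x : ℝ) :
    ‖rsIntegrand φ F s (pt x y)‖ = ‖φ (pt x y)‖ * ‖F (pt x y)‖ * y ^ (s.re + 2) := by
  rw [rsIntegrand_pt φ F s hy, norm_mul, norm_mul, Complex.norm_conj,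
    Complex.norm_cpow_eq_rpow_re_of_pos hy]
  simp

/-- `(x + iy : ℂ) ↦ pt x y`: `ofComplex ⟨x, y⟩ = pt x y`. [folklore] -/
theorem ofComplex_mk_eq_pt (x y : ℝ) : UpperHalfPlane.ofComplex (⟨x, y⟩ : ℂ) = pt x y := rfl

/-! ### Integrability on the strip from growth bounds -/

/-- The four Gamma-type integrals: `y ↦ e^{-2πy}(1 + y^{-A_φ})(y^A + y^{-A}) y^σ` is integrable on
`(0, ∞)` for `σ > A + A_φ - 1`, `A, A_φ ≥ 0`. [folklore] -/
theorem integrableOn_exp_mul_growth {A Aφ σ : ℝ} (hA : 0 ≤ A) (hAφ : 0 ≤ Aφ) (hσ : A + Aφ - 1 < σ) :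
    IntegrableOn (fun y : ℝ ↦ Real.exp (-(2 * π * y)) * (1 + y ^ (-Aφ)) * (y ^ A + y ^ (-A)) * y ^ σ)
      (Ioi 0) := by
  have hb : (0 : ℝ) < 2 * π := by positivity
  have key : ∀ e : ℝ, -1 < e → IntegrableOn (fun y : ℝ ↦ Real.exp (-(2 * π * y)) * y ^ e) (Ioi 0) := by
    intro e he
    refine ((integrableOn_rpow_mul_exp_neg_mul_rpow he le_rfl hb).congr_fun (fun y _ ↦ ?_)
      measurableSet_Ioi)
    show y ^ e * Real.exp (-(2 * π) * y ^ (1 : ℝ)) = Real.exp (-(2 * π * y)) * y ^ e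
    rw [Real.rpow_one, mul_comm, neg_mul]
  have h1 := key (σ + A) (by linarith)
  have h2 := key (σ - A) (by linarith)
  have h3 := key (σ + A - Aφ) (by linarith)
  have h4 := key (σ - A - Aφ) (by linarith)
  refine (((h1.add h2).add h3).add h4).congr_fun (fun y (hy : 0 < y) ↦ ?_) measurableSet_Ioi
  simp only [Pi.add_apply]
  have e1 : y ^ (σ + A) = y ^ σ * y ^ A := Real.rpow_add hy _ _
  have e2 : y ^ (σ - A) = y ^ σ * y ^ (-A) := by rw [sub_eq_add_neg, Real.rpow_add hy]
  have e3 : y ^ (σ + A - Aφ) = y ^ σ * y ^ A * y ^ (-Aφ) := by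
    rw [sub_eq_add_neg, Real.rpow_add hy, Real.rpow_add hy]
  have e4 : y ^ (σ - A - Aφ) = y ^ σ * y ^ (-A) * y ^ (-Aφ) := by
    rw [sub_eq_add_neg, sub_eq_add_neg, Real.rpow_add hy, Real.rpow_add hy]
  rw [e1, e2, e3, e4]
  ring

/-- **Integrability of the unfolded integrand on the strip** from growth bounds: a cusp-form bound
`|φ(τ)| ≤ C_φ e^{-2π Im τ}(1 + (Im τ)^{-A_φ})` and a moderate-growth bound
`|F(τ)| ≤ C_F ((Im τ)^A + (Im τ)^{-A})` give `φ F̄ y^{s+2} ∈ L¹(P, dμ)` for `Re s > A + A_φ - 1`.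
[folklore] -/
theorem integrableOn_rsIntegrand_stripFD {φ F : ℍ → ℂ} (hφm : Measurable φ) (hFm : Measurable F)
    {Cφ CF A Aφ : ℝ} (hA : 0 ≤ A) (hAφ : 0 ≤ Aφ)
    (hφb : ∀ τ : ℍ, ‖φ τ‖ ≤ Cφ * Real.exp (-(2 * π * τ.im)) * (1 + τ.im ^ (-Aφ)))
    (hFb : ∀ τ : ℍ, ‖F τ‖ ≤ CF * (τ.im ^ A + τ.im ^ (-A)))
    {s : ℂ} (hσ : A + Aφ - 1 < s.re) :
    IntegrableOn (rsIntegrand φ F s) stripFD := by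
  have hCφ : 0 ≤ Cφ := by
    have h := hφb UpperHalfPlane.I
    have : 0 < Real.exp (-(2 * π * UpperHalfPlane.I.im)) * (1 + UpperHalfPlane.I.im ^ (-Aφ)) := by
      positivity
    nlinarith [norm_nonneg (φ UpperHalfPlane.I)]
  have hCF : 0 ≤ CF := by
    have h := hFb UpperHalfPlane.I
    have : 0 < UpperHalfPlane.I.im ^ A + UpperHalfPlane.I.im ^ (-A) := by positivity
    nlinarith [norm_nonneg (F UpperHalfPlane.I)]
  have hmeas : Measurable (rsIntegrand φ F s) := measurable_rsIntegrand hφm hFm s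
  refine ⟨hmeas.aestronglyMeasurable, ?_⟩
  -- the bound `B(y)` and its integral
  set B : ℝ → ℝ := fun y ↦ Cφ * CF *
    (Real.exp (-(2 * π * y)) * (1 + y ^ (-Aφ)) * (y ^ A + y ^ (-A)) * y ^ s.re) with hB
  have hBi : IntegrableOn B (Ioi 0) := (integrableOn_exp_mul_growth hA hAφ hσ).const_mul _
  -- pointwise bound in coordinates: `‖rsIntegrand(pt x y)‖ / y² ≤ B(y)`
  have hpt : ∀ y : ℝ, 0 < y → ∀ x : ℝ, ‖rsIntegrand φ F s (pt x y)‖ * (1 / y ^ 2) ≤ B y := by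
    intro y hy x
    rw [norm_rsIntegrand_pt φ F s hy x]
    have h1 := hφb (pt x y)
    have h2 := hFb (pt x y)
    rw [pt_im hy] at h1 h2
    have hy2 : y ^ (s.re + 2) * (1 / y ^ 2) = y ^ s.re := by
      rw [Real.rpow_add hy, Real.rpow_two]; field_simp
    calc ‖φ (pt x y)‖ * ‖F (pt x y)‖ * y ^ (s.re + 2) * (1 / y ^ 2)
        = ‖φ (pt x y)‖ * ‖F (pt x y)‖ * y ^ s.re := by rw [mul_assoc, hy2]
      _ ≤ (Cφ * Real.exp (-(2 * π * y)) * (1 + y ^ (-Aφ))) * (CF * (y ^ A + y ^ (-A))) * y ^ s.re := by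
          refine mul_le_mul_of_nonneg_right (mul_le_mul h1 h2 (norm_nonneg _) ?_)
            (Real.rpow_nonneg hy.le _)
          positivity
      _ = B y := by simp only [hB]; ring
  -- the norm lintegral in coordinates
  unfold HasFiniteIntegral
  have hstrip : stripFD = {ρ : ℍ | 0 ≤ ρ.re ∧ ρ.re < 1} := rfl
  have hco := lintegral_strip_eq_lintegral_Ioi_Ico
    (fun w : ℂ ↦ ‖rsIntegrand φ F s (UpperHalfPlane.ofComplex w)‖ₑ)
    ((hmeas.comp measurable_ofComplex).enorm)
  have hco' : ∫⁻ ρ in stripFD, ‖rsIntegrand φ F s ρ‖ₑ =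
      ∫⁻ y in Ioi (0 : ℝ), ∫⁻ x in Ico (0 : ℝ) 1,
        ‖rsIntegrand φ F s (UpperHalfPlane.ofComplex (⟨x, y⟩ : ℂ))‖ₑ * ENNReal.ofReal (1 / y ^ 2) := by
    rw [hstrip, ← hco]
    refine setLIntegral_congr_fun measurableSet_stripFD (fun ρ _ ↦ ?_)
    simp only [UpperHalfPlane.ofComplex_apply]
  rw [hco']
  calc ∫⁻ y in Ioi (0 : ℝ), ∫⁻ x in Ico (0 : ℝ) 1,
        ‖rsIntegrand φ F s (UpperHalfPlane.ofComplex (⟨x, y⟩ : ℂ))‖ₑ * ENNReal.ofReal (1 / y ^ 2)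
      ≤ ∫⁻ y in Ioi (0 : ℝ), ENNReal.ofReal (B y) := by
        refine setLIntegral_mono' measurableSet_Ioi fun y (hy : 0 < y) ↦ ?_
        calc ∫⁻ x in Ico (0 : ℝ) 1,
              ‖rsIntegrand φ F s (UpperHalfPlane.ofComplex (⟨x, y⟩ : ℂ))‖ₑ * ENNReal.ofReal (1 / y ^ 2)
            ≤ ∫⁻ _x in Ico (0 : ℝ) 1, ENNReal.ofReal (B y) := by
              refine lintegral_mono fun x ↦ ?_
              rw [ofComplex_mk_eq_pt, ← ofReal_norm, ← ENNReal.ofReal_mul (norm_nonneg _)]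
              exact ENNReal.ofReal_le_ofReal (hpt y hy x)
          _ = ENNReal.ofReal (B y) := by
              rw [setLIntegral_const, Real.volume_Ico]; simp
    _ < ∞ := hBi.lintegral_lt_top

/-! ### The strip integral in coordinates and as a Dirichlet series -/

/-- **The strip integral in coordinates**:
`∫_P φ F̄ y^{s+2} dμ = ∫₀^∞ (∫₀¹ φ(x+iy) \overline{F(x+iy)} dx) yˢ dy`. [folklore] -/
theorem setIntegral_stripFD_rsIntegrand (φ F : ℍ → ℂ) (s : ℂ)
    (hint : IntegrableOn (rsIntegrand φ F s) stripFD) :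
    ∫ ρ in stripFD, rsIntegrand φ F s ρ =
      ∫ y in Ioi (0 : ℝ), (∫ x in (0 : ℝ)..1, φ (pt x y) * conj (F (pt x y))) * ((y : ℝ) : ℂ) ^ s := by
  rw [setIntegral_stripFD_eq hint]
  refine setIntegral_congr_fun measurableSet_Ioi fun y (hy : 0 < y) ↦ ?_
  have hy0 : ((y : ℝ) : ℂ) ≠ 0 := Complex.ofReal_ne_zero.mpr hy.ne'
  rw [intervalIntegral.integral_of_le zero_le_one, integral_Ico_eq_integral_Ioo,
    ← integral_Ioc_eq_integral_Ioo]
  simp_rw [rsIntegrand_pt φ F s hy]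
  rw [integral_mul_const, Complex.real_smul, Complex.cpow_add _ _ hy0, Complex.cpow_ofNat]
  push_cast
  field_simp

/-- **The strip integral as a Dirichlet series**: for `q`-series `φ = ∑ a(m) qᵐ` (`a(0) = 0`),
`F = ∑ b(m) qᵐ` with `|a(m)|, |b(m)| ≤ C (m+1)ᵏ` and `Re s > 2k` (and `φ F̄ y^{s+2} ∈ L¹(P)`),
`∫_P φ F̄ y^{s+2} dμ = Γ(s+1) ∑_{m ≥ 1} a(m) \overline{b(m)} (4πm)^{-(s+1)}`. [folklore] -/
theorem setIntegral_stripFD_rsIntegrand_qSeries {a b : ℕ → ℂ} {Ca Cb : ℝ} {k : ℕ}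
    (ha : ∀ m, ‖a m‖ ≤ Ca * ((m : ℝ) + 1) ^ k) (hb : ∀ m, ‖b m‖ ≤ Cb * ((m : ℝ) + 1) ^ k)
    (ha0 : a 0 = 0) (φ F : ℍ → ℂ) (hφq : ∀ τ : ℍ, φ τ = qSeries a τ)
    (hFq : ∀ τ : ℍ, F τ = qSeries b τ) {s : ℂ} (hs : 2 * k < s.re)
    (hint : IntegrableOn (rsIntegrand φ F s) stripFD) :
    ∫ ρ in stripFD, rsIntegrand φ F s ρ =
      Complex.Gamma (s + 1) * ∑' m : ℕ, a (m + 1) * conj (b (m + 1)) *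
        (1 / ((4 * π * ((m : ℝ) + 1) : ℝ) : ℂ)) ^ (s + 1) := by
  rw [setIntegral_stripFD_rsIntegrand φ F s hint, ← integral_Ioi_qSeries_mul_conj_mul_cpow ha hb ha0 hs]
  refine setIntegral_congr_fun measurableSet_Ioi fun y (hy : 0 < y) ↦ ?_
  congr 1
  refine intervalIntegral.integral_congr fun x _ ↦ ?_
  rw [hφq, hFq, coe_pt hy, Complex.mk_eq_add_mul_I]

end Literature.NumberTheory.EllipticCurves.ModularForms
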